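import Summits.CriticalPhenomena.PercolationContinuityZ3.Theorems.PercNearOneGluingNoHeavyQuantSliceDeepLows
import HarnessLib

/-!
# QUANT lane R8, T-DEC: SL-λ* with deep AND shallow lows (Theorem A⁺, part 1) — zeroing the shallow lows, (H_λ) with shallow lows,
# and the pool inequality (LEAD-NOTES-G23 N49 (4)(i))

builds on p205010 (kernel theorem, internal audit signed; external expert review pending)

Support file (`--supports stmt-CriticalPhenomena-4575`), QUANT lane lead seat prim-quant-lead (gen 23), rung R8 of
`run/shared/lean/prim/quant/LADDER.md`.  Two small definitions (`zeroShallow`, `zeroShallowFlow`) and theorems; standard axioms, no sorries.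
Continues Theorem A (`…QuantSliceDeepLows`: deep lows only).

THEOREM A⁺ (`…QuantSliceDeepShallowLows`).  As Theorem A, but a charged low `k ≤ j′` may also be SHALLOW (`T′ ≤ 2(k+a)`, `k ≤ λ`) or
FAR-DEEP (`j′ < k + a`, `k ≤ λ`: its row-1 copy sits above `j′` and needs nothing) provided it is incompatible at `T` with every charged
band-like atom `≤ λ` (`k + w ≤ T`; automatic for far-deep lows); still no true mids `≤ j′ − a`, `g ≥ 1/2`.  Throughout, "shallow" in the
names below means "shallow or far-deep": the zeroing predicate is `k ≤ λ ∧ 2k < T ∧ (T′ ≤ 2(k+a) ∨ j′ < k+a)` (LEAD-NOTES-G23 N51 (3)(b)).  PROOF: run Theorem A on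
the law with its shallow lows ZEROED (`zeroShallow`; the restricted flows `zeroShallowFlow f⁰`, `zeroShallowFlow f^λ` remain witnesses,
`isFlowAtT_zeroShallow`, and the zeroed law satisfies Theorem A's support hypotheses), and send the row-0 copies `(1−g)ν_l` of the shallow lows
into the giant pool: at layer `λ` a shallow low sees only atoms `> λ` (no compatible band-like atom by hypothesis), so (H_λ) in pool form holds
for ALL lows (`pool_of_flow_lam'`) and the pool affords the extra `(1−g)·u·ν(shallow) ≤ g·u·ν(shallow)` (`pool_budget_shallow`, using g ≥ 1/2).
* `zeroShallow`, `zeroShallowFlow`, `isFlowAtT_zeroShallow`, `pool_of_flow_lam'`, `zeroShallow_nonneg/_le/_eq_zero/_of_gt`,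
  `ne_zero_of_zeroShallow_ne_zero`, `sum_Ico_zeroShallow`, **`pool_budget_shallow`**.

[this work]; nothing here is cited as a published result.  The gluing rows served [cite: KozmaNitzan2024, Conjecture 3 (p. 15)]; product
measure [cite: Grimmett1999, §1.3 p. 10].
-/

noncomputable section

namespace Summit.CriticalPhenomena.PercolationContinuityZ3.Theorems

namespace Quant

open Finset

namespace LawDec

/-! ### Theorem A⁺: shallow lows that see no band atom (LEAD-NOTES-G23 N49 (4)(i)) -/

section Shallow

variable (x T g : ℝ) (j' M a lam : ℕ) (ν : ℕ → ℝ) (f0 : ℕ → ℕ → ℝ)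

/-- **the law with its shallow (or far-deep: `j′ < k + a`) lows `≤ λ` zeroed**. [this work] -/
def zeroShallow (T g : ℝ) (j' lam a : ℕ) (ν : ℕ → ℝ) : ℕ → ℝ :=
  fun k => if k ≤ lam ∧ 2 * (k : ℝ) < T ∧ (T + (a : ℝ) * g ≤ 2 * ((k : ℝ) + a) ∨ j' < k + a) then 0 else ν k

/-- **a flow with its shallow (or far-deep) sources `≤ λ` zeroed**. [this work] -/
def zeroShallowFlow (T g : ℝ) (j' lam a : ℕ) (f : ℕ → ℕ → ℝ) : ℕ → ℕ → ℝ :=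
  fun l h => if l ≤ lam ∧ 2 * (l : ℝ) < T ∧ (T + (a : ℝ) * g ≤ 2 * ((l : ℝ) + a) ∨ j' < l + a) then 0 else f l h

/-- zeroing the shallow lows of the law and of a flow witness keeps the witness (at any layer `J ≤ j′`... any layer). [this work] -/
theorem isFlowAtT_zeroShallow (J : ℕ) (f : ℕ → ℕ → ℝ) (hx0 : 0 < x) (hx1 : x < 1) (hlamJ : lam ≤ J)
    (hf : IsFlowAtT x T J M ν f) :
    IsFlowAtT x T J M (zeroShallow T g j' lam a ν) (zeroShallowFlow T g j' lam a f) := by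
  refine ⟨?_, ?_, ?_, ?_⟩
  · intro l h
    unfold zeroShallowFlow
    split_ifs
    · exact le_rfl
    · exact hf.1 l h
  · intro l h hlh
    unfold zeroShallowFlow at hlh
    split_ifs at hlh with hs
    · exact absurd hlh (lt_irrefl _)
    · exact hf.2.1 l h hlh
  · intro l hl hlow
    unfold zeroShallow zeroShallowFlow
    by_cases hs : l ≤ lam ∧ 2 * (l : ℝ) < T ∧ (T + (a : ℝ) * g ≤ 2 * ((l : ℝ) + a) ∨ j' < l + a)
    · rw [if_pos hs]
      exact Finset.sum_eq_zero fun h _ => by rw [if_pos hs]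
    · rw [if_neg hs, ← hf.2.2.1 l hl hlow]
      exact Finset.sum_congr rfl fun h _ => by rw [if_neg hs]
  · intro h hhM hc
    unfold zeroShallow zeroShallowFlow
    have hns : ¬ (h ≤ lam ∧ 2 * (h : ℝ) < T ∧ (T + (a : ℝ) * g ≤ 2 * ((h : ℝ) + a) ∨ j' < h + a)) := by
      rintro ⟨hhj, hlow, -⟩
      rcases hc with hc | hc
      · omega
      · linarith
    rw [if_neg hns]
    refine le_trans (Finset.sum_le_sum fun l _ => ?_) (hf.2.2.2 h hhM hc)
    split_ifs with hs
    · rw [mul_zero]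
      rcases (hf.1 l h).eq_or_lt with hz | hp
      · rw [← hz, mul_zero]
      · obtain ⟨hlJ, hlow, -, hc'⟩ := hf.2.1 l h hp
        have hlh : l < h := by
          rcases hc' with hc' | hc'
          · omega
          · have : (l : ℝ) < h := by linarith
            exact_mod_cast this
        exact (mul_pos (usage_pos_of_compat x T J l h hx0 hx1 hlow hlh hc') hp).le
    · exact le_rfl

/-- **(H_λ) in pool form with shallow lows**: if every charged low `≤ j′` is either deep or shallow-and-incompatible at `T` with every
charged band-like atom `≤ λ`, then at layer `λ` every low sees only atoms `> λ`: `u·ν(lows) ≤ ν(>λ)`. [this work] -/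
theorem pool_of_flow_lam' (fl : ℕ → ℕ → ℝ) (hx0 : 0 < x) (hx1 : x < 1) (hg0 : 0 ≤ g) (hg1 : g ≤ 1)
    (hfl : IsFlowAtT x T lam M ν fl) (hlamj : lam ≤ j')
    (hlows : ∀ k, k ≤ j' → 2 * (k : ℝ) < T → ν k ≠ 0 →
      (2 * ((k : ℝ) + a) < T + (a : ℝ) * g ∧ k + a ≤ j') ∨
      ((T + (a : ℝ) * g ≤ 2 * ((k : ℝ) + a) ∨ j' < k + a) ∧ k ≤ lam ∧
        ∀ w, w ≤ lam → T ≤ 2 * (w : ℝ) → ν w ≠ 0 → (k : ℝ) + w ≤ T))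
    (hbelow : ∀ k, k ≤ lam → T ≤ 2 * (k : ℝ) → ν k ≠ 0 → 2 * (k : ℝ) ≤ T + (a : ℝ) * g)
    (habove : ∀ k, lam < k → k ≤ j' → ν k ≠ 0 → T + (a : ℝ) * g < 2 * (k : ℝ)) :
    x / (1 - x) * ∑ l ∈ Finset.range (j' + 1), (if 2 * (l : ℝ) < T then ν l else 0)
      ≤ ∑ h ∈ Finset.Ico (lam + 1) (M + 1), ν h := by
  have hag : 0 ≤ (a : ℝ) * g := mul_nonneg (Nat.cast_nonneg a) hg0
  have hgiant : ∀ l h, 0 < fl l h → lam + 1 ≤ h := by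
    intro l h hlh
    obtain ⟨hl, hlow, hhM, hc⟩ := hfl.2.1 l h hlh
    rcases hc with hc | hc
    · exact hc
    by_contra hle
    have hle' : h ≤ lam := by omega
    have hνl : 0 < ν l := by
      rw [← hfl.2.2.1 l hl hlow]
      exact lt_of_lt_of_le hlh (Finset.single_le_sum (fun h _ => hfl.1 l h) (Finset.mem_range.2 (by omega)))
    have h2 : T ≤ 2 * (h : ℝ) := by linarith
    have hlh' : l < h := by
      have : (l : ℝ) < h := by linarith
      exact_mod_cast this
    have hupos := usage_pos_of_compat x T lam l h hx0 hx1 hlow hlh' (Or.inr hc)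
    have hcap := hfl.2.2.2 h hhM (Or.inr h2)
    have hterm : usage x T lam l h * fl l h ≤ ∑ l' ∈ Finset.range (lam + 1), usage x T lam l' h * fl l' h := by
      refine Finset.single_le_sum (f := fun l' => usage x T lam l' h * fl l' h) (fun l' _ => ?_)
        (Finset.mem_range.2 (by omega))
      show 0 ≤ usage x T lam l' h * fl l' h
      rcases (hfl.1 l' h).eq_or_lt with hz | hp
      · rw [← hz, mul_zero]
      · obtain ⟨-, hlow', -, hc'⟩ := hfl.2.1 l' h hp
        have hl'h : l' < h := by
          rcases hc' with hc' | hc'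
          · omega
          · have : (l' : ℝ) < h := by linarith
            exact_mod_cast this
        exact (mul_pos (usage_pos_of_compat x T lam l' h hx0 hx1 hlow' hl'h hc') hp).le
    have hνh : 0 < ν h := lt_of_lt_of_le (lt_of_lt_of_le (mul_pos hupos hlh) hterm) hcap
    have hb := hbelow h hle' h2 hνh.ne'
    have ha0 : (0 : ℝ) ≤ a := Nat.cast_nonneg a
    rcases hlows l (hl.trans hlamj) hlow hνl.ne' with ⟨hd, -⟩ | ⟨-, -, hinc⟩
    · nlinarith
    · have := hinc h hle' h2 hνh.ne'
      linarith
  have hzero : ∀ l, l ≤ j' → 2 * (l : ℝ) < T → lam < l → ν l = 0 := by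
    intro l hl hlow hlt
    by_contra hne
    have := habove l hlt hl hne
    linarith
  have e1 : ∑ l ∈ Finset.range (j' + 1), (if 2 * (l : ℝ) < T then ν l else 0)
      = ∑ l ∈ Finset.range (lam + 1), (if 2 * (l : ℝ) < T then ν l else 0) := by
    symm
    refine Finset.sum_subset (Finset.range_mono (by omega)) fun l hl hnl => ?_
    rw [Finset.mem_range] at hl hnl
    split_ifs with hlow
    · exact hzero l (by omega) hlow (by omega)
    · rfl
  rw [e1, Finset.mul_sum]
  have e2 : ∀ l ∈ Finset.range (lam + 1), x / (1 - x) * (if 2 * (l : ℝ) < T then ν l else 0)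
      = ∑ h ∈ Finset.range (M + 1), (if 2 * (l : ℝ) < T then x / (1 - x) * fl l h else 0) := by
    intro l hl
    have hl' : l ≤ lam := Nat.lt_succ_iff.1 (Finset.mem_range.1 hl)
    split_ifs with hlow
    · rw [← hfl.2.2.1 l hl' hlow, Finset.mul_sum]
    · rw [mul_zero, Finset.sum_const_zero]
  rw [Finset.sum_congr rfl e2, Finset.sum_comm, ← sum_range_ite_gt_eq_Ico lam M ν]
  refine Finset.sum_le_sum fun h hh => ?_
  have hhM : h ≤ M := Nat.lt_succ_iff.1 (Finset.mem_range.1 hh)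
  by_cases hgi : lam + 1 ≤ h
  · rw [if_pos hgi]
    refine le_trans (Finset.sum_le_sum fun l _ => ?_) (hfl.2.2.2 h hhM (Or.inl hgi))
    split_ifs with hlow
    · rw [usage_giant_eq x T lam l h hgi]
    · rcases (hfl.1 l h).eq_or_lt with hz | hp
      · rw [← hz, mul_zero]
      · exact absurd (hfl.2.1 l h hp).2.1 hlow
  · rw [if_neg hgi]
    refine (Finset.sum_eq_zero fun l _ => ?_).le
    split_ifs with hlow
    · rcases (hfl.1 l h).eq_or_lt with hz | hp
      · rw [← hz, mul_zero]
      · exact absurd (hgiant l h hp) hgi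
    · rfl

end Shallow

/-! ### Theorem A⁺ continued: the pool with shallow lows, the witness, the theorem -/

section ShallowMain

variable (x T g : ℝ) (j' M a lam : ℕ) (ν : ℕ → ℝ) (f0 : ℕ → ℕ → ℝ)

/-- the zeroed law is nonnegative. -/
theorem zeroShallow_nonneg (hν : ∀ k, 0 ≤ ν k) (k : ℕ) : 0 ≤ zeroShallow T g j' lam a ν k := by
  unfold zeroShallow; split_ifs
  · exact le_rfl
  · exact hν k

/-- the zeroed law is below the law. -/
theorem zeroShallow_le (hν : ∀ k, 0 ≤ ν k) (k : ℕ) : zeroShallow T g j' lam a ν k ≤ ν k := by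
  unfold zeroShallow; split_ifs
  · exact hν k
  · exact le_rfl

/-- the zeroed law vanishes above `M`. -/
theorem zeroShallow_eq_zero (hνM : ∀ k, M < k → ν k = 0) (k : ℕ) (hk : M < k) : zeroShallow T g j' lam a ν k = 0 := by
  unfold zeroShallow; split_ifs
  · rfl
  · exact hνM k hk

/-- the zeroed law agrees with the law off the shallow lows; in particular above `λ`. -/
theorem zeroShallow_of_gt (k : ℕ) (hk : lam < k) : zeroShallow T g j' lam a ν k = ν k := by
  unfold zeroShallow; rw [if_neg (fun h => by omega)]

/-- a charged atom of the zeroed law is a charged atom of the law. -/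
theorem ne_zero_of_zeroShallow_ne_zero (k : ℕ) (hk : zeroShallow T g j' lam a ν k ≠ 0) : ν k ≠ 0 := by
  unfold zeroShallow at hk; split_ifs at hk
  · exact absurd rfl hk
  · exact hk

/-- sums of the zeroed law over atoms above `λ`. -/
theorem sum_Ico_zeroShallow (n : ℕ) (hn : lam + 1 ≤ n) :
    ∑ h ∈ Finset.Ico n (M + 1), zeroShallow T g j' lam a ν h = ∑ h ∈ Finset.Ico n (M + 1), ν h :=
  Finset.sum_congr rfl fun h hh => zeroShallow_of_gt T g j' a lam ν h (by rw [Finset.mem_Ico] at hh; omega)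

/-- **THE POOL INEQUALITY WITH SHALLOW LOWS**: the pool-bound mass of the deep routing (run on the zeroed law) plus the row-0 copies of the
shallow lows fit into the pool: `u·(Σ dlRest_D + (1−g)·ν(shallow)) ≤ (1−g)·ν(>j′) + g·ν(>λ)`. [this work] -/
theorem pool_budget_shallow (fl : ℕ → ℕ → ℝ) (hx0 : 0 < x) (hx1 : x < 1) (hg0 : 0 ≤ g) (hg1 : g ≤ 1) (hg2 : 1 / 2 ≤ g)
    (hν : ∀ k, 0 ≤ ν k) (hf0 : IsFlowAtT x T j' M ν f0) (hfl : IsFlowAtT x T lam M ν fl) (hlamj : lam ≤ j')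
    (hlows : ∀ k, k ≤ j' → 2 * (k : ℝ) < T → ν k ≠ 0 →
      (2 * ((k : ℝ) + a) < T + (a : ℝ) * g ∧ k + a ≤ j') ∨
      ((T + (a : ℝ) * g ≤ 2 * ((k : ℝ) + a) ∨ j' < k + a) ∧ k ≤ lam ∧
        ∀ w, w ≤ lam → T ≤ 2 * (w : ℝ) → ν w ≠ 0 → (k : ℝ) + w ≤ T))
    (hbelow : ∀ k, k ≤ lam → T ≤ 2 * (k : ℝ) → ν k ≠ 0 → 2 * (k : ℝ) ≤ T + (a : ℝ) * g)
    (habove : ∀ k, lam < k → k ≤ j' → ν k ≠ 0 → T + (a : ℝ) * g < 2 * (k : ℝ)) :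
    x / (1 - x) * (∑ l ∈ Finset.range (j' + 1), (if 2 * (l : ℝ) < T then
        dlRest x T g j' a (zeroShallow T g j' lam a ν) (zeroShallowFlow T g j' lam a f0) l else 0)
      + (1 - g) * ∑ l ∈ Finset.range (j' + 1),
        (if l ≤ lam ∧ 2 * (l : ℝ) < T ∧ (T + (a : ℝ) * g ≤ 2 * ((l : ℝ) + a) ∨ j' < l + a) then ν l else 0))
      ≤ (1 - g) * ∑ h ∈ Finset.Ico (j' + 1) (M + 1), ν h + g * ∑ h ∈ Finset.Ico (lam + 1) (M + 1), ν h := by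
  set νD := zeroShallow T g j' lam a ν with hνD
  set f0D := zeroShallowFlow T g j' lam a f0 with hf0D
  have hu : 0 < x / (1 - x) := div_pos hx0 (by linarith)
  have hνD0 : ∀ k, 0 ≤ νD k := zeroShallow_nonneg T g j' a lam ν hν
  have hf0D' : IsFlowAtT x T j' M νD f0D := isFlowAtT_zeroShallow x T g j' M a lam ν j' f0 hx0 hx1 hlamj hf0
  have hdeepD : ∀ k, k ≤ j' → 2 * (k : ℝ) < T → νD k ≠ 0 → 2 * ((k : ℝ) + a) < T + (a : ℝ) * g ∧ k + a ≤ j' := by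
    intro k hk hlow hne
    have hne' := ne_zero_of_zeroShallow_ne_zero T g j' a lam ν k hne
    rcases hlows k hk hlow hne' with hd | ⟨hs, hkl, -⟩
    · exact hd
    · exfalso; apply hne; simp only [hνD]; unfold zeroShallow; rw [if_pos ⟨hkl, hlow, hs⟩]
  -- ingredients
  have hC : (1 - g) * ∑ l ∈ Finset.range (j' + 1), (if 2 * (l : ℝ) < T then ∑ m ∈ Finset.range (j' + 1), f0D l m else 0)
      ≤ ∑ l ∈ Finset.range (j' + 1), (if 2 * (l : ℝ) < T then ∑ m ∈ Finset.range (j' + 1), dlAd x T g j' a νD f0D l m else 0) := by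
    rw [Finset.mul_sum]
    refine Finset.sum_le_sum fun l hl => ?_
    have hl' : l ≤ j' := Nat.lt_succ_iff.1 (Finset.mem_range.1 hl)
    split_ifs with hlow
    · exact sum_dlAd_ge x T g j' M a νD f0D hx0 hx1 hg1 hg2 hνD0 hf0D' hdeepD l hl' hlow
    · simp
  have hB := pool_of_flow_top x T j' M νD f0D hx0 hx1 hf0D'
  have hA := pool_of_flow_lam' x T g j' M a lam ν fl hx0 hx1 hg0 hg1 hfl hlamj hlows hbelow habove
  -- the lows of ν = the lows of νD + the shallow lows
  have e1 : ∑ l ∈ Finset.range (j' + 1), (if 2 * (l : ℝ) < T then ν l else 0)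
      = ∑ l ∈ Finset.range (j' + 1), (if 2 * (l : ℝ) < T then νD l else 0)
        + ∑ l ∈ Finset.range (j' + 1), (if l ≤ lam ∧ 2 * (l : ℝ) < T ∧ (T + (a : ℝ) * g ≤ 2 * ((l : ℝ) + a) ∨ j' < l + a) then ν l else 0) := by
    rw [← Finset.sum_add_distrib]
    refine Finset.sum_congr rfl fun l _ => ?_
    simp only [hνD]
    unfold zeroShallow
    by_cases hs : l ≤ lam ∧ 2 * (l : ℝ) < T ∧ (T + (a : ℝ) * g ≤ 2 * ((l : ℝ) + a) ∨ j' < l + a)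
    · rw [if_pos hs, if_pos hs, if_pos hs.2.1, if_pos hs.2.1]; ring
    · rw [if_neg hs, if_neg hs, add_zero]
  have e2 : ∑ h ∈ Finset.Ico (j' + 1) (M + 1), νD h = ∑ h ∈ Finset.Ico (j' + 1) (M + 1), ν h :=
    sum_Ico_zeroShallow T g j' M a lam ν (j' + 1) (by omega)
  rw [e2] at hB
  -- dlRest = νD − Σ dlAd
  have e3 : ∑ l ∈ Finset.range (j' + 1), (if 2 * (l : ℝ) < T then dlRest x T g j' a νD f0D l else 0)
      = ∑ l ∈ Finset.range (j' + 1), (if 2 * (l : ℝ) < T then νD l else 0)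
        - ∑ l ∈ Finset.range (j' + 1), (if 2 * (l : ℝ) < T then ∑ m ∈ Finset.range (j' + 1), dlAd x T g j' a νD f0D l m else 0) := by
    rw [← Finset.sum_sub_distrib]
    refine Finset.sum_congr rfl fun l _ => ?_
    unfold dlRest
    split_ifs <;> ring
  rw [e3]
  rw [e1] at hA
  set SD := ∑ l ∈ Finset.range (j' + 1), (if 2 * (l : ℝ) < T then νD l else 0)
  set Ssh := ∑ l ∈ Finset.range (j' + 1), (if l ≤ lam ∧ 2 * (l : ℝ) < T ∧ (T + (a : ℝ) * g ≤ 2 * ((l : ℝ) + a) ∨ j' < l + a) then ν l else 0)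
  set F := ∑ l ∈ Finset.range (j' + 1), (if 2 * (l : ℝ) < T then ∑ m ∈ Finset.range (j' + 1), f0D l m else 0)
  set D := ∑ l ∈ Finset.range (j' + 1), (if 2 * (l : ℝ) < T then ∑ m ∈ Finset.range (j' + 1), dlAd x T g j' a νD f0D l m else 0)
  set Gj := ∑ h ∈ Finset.Ico (j' + 1) (M + 1), ν h
  set Gl := ∑ h ∈ Finset.Ico (lam + 1) (M + 1), ν h
  have hSsh : 0 ≤ Ssh := Finset.sum_nonneg fun l _ => by
    split_ifs
    · exact hν l
    · exact le_rfl
  have h1 := mul_le_mul_of_nonneg_left hA hg0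
  have h2 := mul_le_mul_of_nonneg_left hB (show 0 ≤ 1 - g by linarith)
  have h3 := mul_le_mul_of_nonneg_left hC hu.le
  have h4 : (1 - g) * (x / (1 - x) * Ssh) ≤ g * (x / (1 - x) * Ssh) :=
    mul_le_mul_of_nonneg_right (by linarith) (mul_nonneg hu.le hSsh)
  have hmix : x / (1 - x) * SD = g * (x / (1 - x) * SD) + (1 - g) * (x / (1 - x) * SD) := by ring
  nlinarith


end ShallowMain

end LawDec

end Quant

end Summit.CriticalPhenomena.PercolationContinuityZ3.Theorems
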